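import Mathlib
import Summits.ResolutionOfSingularities.ResolutionOfSingularities.Theorems.RadicialJungCleanModelsL7bGlobalCleanPermSeq
import Literature.AlgebraicGeometry.Resolution.RegularBlowup
import Literature.AlgebraicGeometry.Resolution.QuasiExcellentBlowup
import Literature.AlgebraicGeometry.Resolution.BlowupDimension
import Literature.AlgebraicGeometry.Motives.VarietiesDimensionProofs
import HarnessLib

/-!
# Route `RadicialJung`, crux `CleanModels` (stmt-ResolutionOfSingularities-15917), line `Sketch` rev 35, stub 6 `stub_cleanProp44` (X44c):
# the stages of a clean-permissible sequence for `(J, μ)` over a regular quasi-excellent Noetherian threefold, and the curve-centre step FROM BASE DATA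

Memo `Cruxes/CleanModels/Lines/Sketch-memo-hand2-g10-stubs-5-7.md` §3.  ✓ `exists_isCleanPermissibleSeq_blowup_curve` (`…L7bGlobalCleanPermSeq.lean`) asks of the
current top `X₁` of the sequence `π : X₁ → X`: Noetherian, regular, quasi-excellent, `dim 𝒪_{X₁,x} ≤ 3`.  All four descend from the base `X` of X44c
along the sequence (`IsCleanPermissibleSeq.stage_data`: stage by stage ✓ `IsBlowup.isRegular_of_isRegular_subscheme`, ✓ `IsBlowup.isQuasiExcellent`,
✓ `IsBlowup.topologicalKrullDim_le`, properness), so the curve-centre step is available from BASE DATA ONLY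
(`exists_isCleanPermissibleSeq_blowup_curve_of_base`): `X` Noetherian regular quasi-excellent with `topologicalKrullDim X ≤ 3`, the line of `G`
clean-regular everywhere (`char p`) — exactly the standing hypotheses inside `stub_cleanProp44` — plus the curve `C₀ = cl{η}` of the `μ`-stratum.

Honest framing: OURS (bookkeeping); nothing here proves X44c or any case of `CleanModels`.
-/

noncomputable section

set_option linter.dupNamespace false -- mandated namespace of this single-conjunct summit

open CategoryTheory AlgebraicGeometry TopologicalSpace IsLocalRing Opposite
open Literature.AlgebraicGeometry.Resolution Literature.AlgebraicGeometry.Motives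
open Scheme.IdealSheafData

namespace Summit.ResolutionOfSingularities.ResolutionOfSingularities.Theorems.RadicialJung.CleanModels

/-- **Stage data along a clean-permissible sequence**: the top is locally Noetherian, regular, quasi-excellent, proper over the base, of dimension
`≤ n` if the base is. [cite: Liu2002, Thm. 8.1.19 (a)] [cite: StacksProject, Tag 07QU] [cite: Matsumura1987, Thm. 15.5] -/
theorem IsCleanPermissibleSeq.stage_data {p : ℕ} {X' X : Scheme.{0}} [IsIntegral X'] [IsIntegral X] {π : X' ⟶ X} [IsDominant π]
    {J : X.IdealSheafData} {μ : ℕ} {J' : X'.IdealSheafData} {G : X.functionField} (h : IsCleanPermissibleSeq p π J μ J' G) {n : ℕ} :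
    IsLocallyNoetherian X → Scheme.IsRegular X → Scheme.IsQuasiExcellent X → topologicalKrullDim X ≤ n →
      IsLocallyNoetherian X' ∧ Scheme.IsRegular X' ∧ Scheme.IsQuasiExcellent X' ∧ IsProper π ∧ topologicalKrullDim X' ≤ n := by
  induction h with
  | nil J μ G => exact fun hN hX hE hdim => ⟨hN, hX, hE, inferInstance, hdim⟩
  | @cons X'' X' X _ _ _ τ _ π _ J μ J' G Y hπ hint hreg hY hτ hperm ih =>
    intro hN hX hE hdim
    haveI := hN
    obtain ⟨hN', hR', hE', hP', hdim'⟩ := ih hN hX hE hdim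
    haveI := hN'
    haveI := hP'
    haveI : IsProper τ := hτ.isProper
    haveI : IsLocallyNoetherian X'' := LocallyOfFiniteType.isLocallyNoetherian τ
    exact ⟨inferInstance, hτ.isRegular_of_isRegular_subscheme hR' hreg, hτ.isQuasiExcellent hE', inferInstance,
      hτ.topologicalKrullDim_le hdim'⟩

/-- **The curve-centre step of [CoP1] Prop. 4.4 (clean version) from BASE data.**  `X` integral Noetherian regular quasi-excellent of dimension `≤ 3`,
the line of `G` clean-regular everywhere (`char p`), `π : X₁ → X` a clean-permissible sequence for `(J, μ)` with transform `J₁` of order `≤ μ`, and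
`C₀ = cl{η} ⊆ X₁` a regular curve (regular pair at each point) inside `{ord J₁ = μ}`: then L7b-global's `σ` followed by the blow-up `τ` of the strict
transform extends the sequence, with `ord ≤ μ` afterwards. [cite: CossartPiltant2008, Prop. 4.4 and Prop. 4.2 (a)] [cite: Piltant2013, §2 Axiom 4] -/
theorem exists_isCleanPermissibleSeq_blowup_curve_of_base (p : ℕ) [hp : Fact p.Prime] {X X₁ : Scheme.{0}} [IsIntegral X] [IsNoetherian X]
    [IsIntegral X₁] {π : X₁ ⟶ X} [IsDominant π] {J : X.IdealSheafData} {μ : ℕ} {J₁ : X₁.IdealSheafData} {G : X.functionField}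
    [CharP X.functionField p] (hπ : IsCleanPermissibleSeq p π J μ J₁ G)
    (hG : ∀ x : X, CleanRegAt p (algebraMap (X.presheaf.stalk x) X.functionField) G) (hX : Scheme.IsRegular X)
    (hE : Scheme.IsQuasiExcellent X) (hdim : topologicalKrullDim X ≤ 3) (hJ₁le : ∀ x : X₁, idealOrder J₁ x ≤ μ) {C₀ : Closeds X₁}
    (hC₀reg : ∀ y ∈ (C₀ : Set X₁), ∃ c : Fin 2 → X₁.presheaf.stalk y, IsRsopPart c ∧ Ideal.span (Set.range c) = stalkIdeal (vanishingIdeal C₀) y)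
    {η : X₁} (hη : (C₀ : Set X₁) = closure {η}) (hC₀μ : ∀ y ∈ (C₀ : Set X₁), idealOrder J₁ y = μ) :
    ∃ (X' : Scheme.{0}) (_ : IsIntegral X') (_ : IsNoetherian X') (σ : X' ⟶ X₁) (_ : IsDominant σ) (C : Closeds X') (η' : X')
      (J' : X'.IdealSheafData) (X'' : Scheme.{0}) (_ : IsIntegral X'') (_ : IsNoetherian X'') (τ : X'' ⟶ X') (_ : IsDominant τ),
      (C : Set X') = closure {η'} ∧ σ η' = η ∧
      (∀ y ∈ (C : Set X'), ∃ c : Fin 2 → X'.presheaf.stalk y, IsRsopPart c ∧ Ideal.span (Set.range c) = stalkIdeal (vanishingIdeal C) y) ∧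
      (∀ y ∈ (C : Set X'), idealOrder J' y = μ) ∧ (∀ x' : X', idealOrder J' x' ≤ μ) ∧
      IsCleanPermissibleSeq p (σ ≫ π) J μ J' G ∧ IsBlowup τ (vanishingIdeal C) ∧
      IsCleanPermissibleSeq p (τ ≫ σ ≫ π) J μ (controlledTransform τ (vanishingIdeal C) J' μ) G ∧
      ∀ x'' : X'', idealOrder (controlledTransform τ (vanishingIdeal C) J' μ) x'' ≤ μ := by
  obtain ⟨hN₁, hX₁, hE₁, hP₁, hdim₁⟩ := hπ.stage_data inferInstance hX hE hdim
  haveI := hN₁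
  haveI := hP₁
  haveI : CompactSpace X₁ := QuasiCompact.compactSpace_of_compactSpace π
  haveI : IsNoetherian X₁ := {}
  have hX3 : ∀ x : X₁, ringKrullDim (X₁.presheaf.stalk x) ≤ 3 := fun x => by
    -- `dim 𝒪_{X₁,x} ≤ dim X₁` (Görtz–Wedhorn I, Lemma 5.7 (4))
    have h1 : ringKrullDim (X₁.presheaf.stalk x) ≤ topologicalKrullDim X₁ := by
      rw [Literature.AlgebraicGeometry.Motives.Scheme.topologicalKrullDim_eq_iSup_ringKrullDim_stalk]
      exact le_iSup (fun x : X₁ => ringKrullDim (X₁.presheaf.stalk x)) x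
    exact h1.trans (by exact_mod_cast hdim₁)
  exact exists_isCleanPermissibleSeq_blowup_curve p hπ hG hX₁ hE₁ hX3 hJ₁le hC₀reg hη hC₀μ

end Summit.ResolutionOfSingularities.ResolutionOfSingularities.Theorems.RadicialJung.CleanModels

end
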